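import Literature.MathematicalPhysics.QuantumFieldTheory.Balaban1983to89.B9Thm311SitePrimeFormCoercive
import Literature.MathematicalPhysics.QuantumFieldTheory.Balaban1983to89.B9Eq319QprimeBlockLocal
import Literature.MathematicalPhysics.QuantumFieldTheory.Balaban1983to89.B9Eq333ProjectionCovariance

/-!
# `Balaban1983to89.B9Thm311SitePrimeFormCoerciveBlockGauge` — T. Bałaban, *Propagators for lattice gauge theories in a background field*, Commun.
# Math. Phys. **99** (1985) 389–434 [Balaban1985BackgroundPropagators] (3.24) p. 394, p. 395, (3.31)–(3.32) p. 395, (3.35) p. 396, Thm 3.11 p. 416,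
# with [Balaban1983RegularityDecay] (2.27) p. 580 and [Balaban1985Averaging] pp. 24–25: THE SITE OPERATOR `Δ′_{a′}(U) = D*_U D_U + a′Q′(U)*Q′(U)`
# IS **STRONGLY** COERCIVE AT EVERY BACKGROUND WHOSE BLOCKS CARRY A SMALL-BOND GAUGE — `γ″·(‖D_Uλ‖² + (1 − κ)(ηL)⁻²‖λ‖²) ≤ re⟨λ, Δ′_{a′}(U)λ⟩`,
# `γ″ = 1∕(3 + 4∕a′)`, `κ = 2d(L−1)L·ε² + 4ρ′(ε)²` — BY THE BLOCK POINCARÉ INEQUALITY WITH MEANS RUN BLOCK BY BLOCK IN THE BLOCK's OWN GAUGE;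
# no global bond window, no closed line, no partition of unity — R2′ STEP B8′ (v) «Tier P for the site operator» of `t4/ROUTES-NE9.md` v13.21

statement-level skeleton of published theorems with citation tags; proofs where landed; nothing here is a claim about the Yang–Mills mass gap

PDF held: `paper:balaban1985-cmp99-background-propagators` pp. 394–396, 416 (via the quotations of `B9Thm311DeltaPrimeA`, `B9Eq328GaugeAction`,
`B7Eq44TorusAxialGaugeLocal` and p0005∕p0028 opened by this lineage); `paper:balaban1983-cmp89-regularity-decay` p. 580 via `B9Eq323FlatBlockPoincare`.
THE PRINT (verbatim): [B9] p. 394 *«Δ′_a(U) = Δ_U + Q′(U)*a′Q′(U) (3.24)»*; p. 395 *«it can be easily shown that the operator Δ′_a is positive»*;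
(3.31)–(3.32) p. 395 *«Δ_{U^u}R(u) = R(u)Δ_U … R(U^u(Γ_{y,x})) = R(u(y))R(U(Γ_{y,x}))R(u⁻¹(x))»*; (3.35) p. 396 *«there exists a gauge transformation u
on □ such that U^u = e^{iηA} … |A| … ≤ O(1)Mα₀»*; Thm 3.11 p. 416 *«Δ′_a, G′, (Q′G′²Q′*)⁻¹, Δ_a, G are positive definite»*, proof p. 416 *«positivity of
the operators G_□ … Doing the gauge transformation we get U = e^{iηA} with A small»*; [B4] (2.27) *«⟨φ, (−Δ^{η,N}_Δ + a_kP_k)φ⟩ ≥ min{π², a_k}‖φ‖²»*.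

WHY THIS FILE (cell context).  ROUTES-NE9 v13.21 §L1.2 l.413 (v)∕(x): «the PLAQUETTE-CLASS upgrade of (I1)» — move the strong coercivity of the site
operator (`B9Thm311SitePrimeFormCoercive[Canonical]`, the GLOBAL scaled bond window) to print's class (3.35).  The site operator's letters have range
ONE BLOCK (`D_U`: one bond; `Q′(U)`: the in-block contours `Γ_{y,x}`, `B9Eq319QprimeBlockLocal`), so the locality reduction of p. 416 can be done BLOCK BY
BLOCK: in a gauge `u_y` of the block `B(y)` in which the INTERNAL bonds of `B(y)` are `ε`-close to the identity, the block Poincaré-with-means argument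
of the parent's §1 runs AT `U` — for `h := R(u_y)λ` on `B(y)`, `‖h(b₊) − h(b₋)‖ ≤ |η|‖(D_{U^{u_y}}h)(b)‖ + ε‖h(b₊)‖ = |η|‖(D_Uλ)(b)‖ + ε‖λ(b₊)‖`
((3.31) + the fibrewise isometry `hAd`) and `‖mean_{B(y)}h‖ ≤ ‖(Q′(U^{u_y})h)(y)‖ + ρ′·L^{−d}Σ_{B(y)}‖λ‖ = ‖(Q′(U)λ)(y)‖ + …` ((3.32) + the local
(ρ′) letter).  The gauges are DISPLAYED here (one per block, arbitrary off the block); the sequel `B9Thm311SitePrimeFormCoercivePlaquette` produces them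
from small plaquette variables by the LOCAL axial gauge of `B7Eq44TorusAxialGaugeLocal` (linear count `d(L−1)δ`), which is what makes `(L−1)L·ε²` free
of `η` along `δ ≤ α₀η²`, `ηL ≤ 1`.

WHAT IS PROVED (sorry-free; 0 `def`; [folklore] finite-lattice quadratic-form bookkeeping; no inequality of the papers asserted).
* §1 `norm_AdW_of_inner` (fibrewise isometry ⇒ norm preserved); **`sum_block_norm_sq_le_poincare_mean`** — the parent's Poincaré WITH MEANS on ONE block:
  `Σ_{x∈B(y)}‖g x‖² ≤ 2·((L−1)L∕2)·Σ_{b ⊂ B(y)}‖g(b₊) − g(b₋)‖² + 2L^d·‖L^{−d}Σ_{x∈B(y)} g x‖²`.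
* §2 **`sum_block_norm_sq_le_blockGauge`** — AT `U`, ONE BLOCK, in the block's gauge `g y`:
  `Σ_{x∈B(y)}‖λ x‖² ≤ (L−1)L·Σ_{b ⊂ B(y)}(2η²‖(D_Uλ)(b)‖² + 2ε²‖λ(b₊)‖²) + 4L^d‖(Q′(U)λ)(y)‖² + 4ρ′²·Σ_{x∈B(y)}‖λ x‖²`.
* §3 **`norm_sq_le_site_squares_blockGauge`** — summed over the blocks in the chain's weighted currency:
  `(1 − κ)‖λ‖² ≤ 2(L−1)Lη²·‖D_Uλ‖² + 4(c₀L^d∕c₁)·‖Q̃′(U)λ‖²`, `κ = 2d(L−1)Lε² + 4ρ′²`, `ρ′ = (1 + ε)^{d(L−1)} − 1`.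
* §4 **`site_strong_coercive_blockGauge`** — along `c₁(ηL)² = c₀L^d`: `(1∕(3 + 4∕a′))·(‖D_Uλ‖² + (1 − κ)(ηL)⁻²‖λ‖²) ≤ re⟨λ, Δ′_{a′}(U)λ⟩` (with `hRS`).
MODEL ∕ DECLARED READINGS.  (M1) the chain's site letters (`laplacePrimeA`, `QprimeW`, `covDerivL2K` at `adTransportW φ U`), one averaging step on
`Π_i ℤ/(L·m_i)ℤ`, weights `c₀, c₁`; (M2) DISPLAYED: the block gauges `g : TSite d m → (TSite d (L·m) → 𝔸ˣ)` with the fibrewise isometry `hAd` of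
each `R(g y x)` and the closeness `ε` of the transporters of `U^{g y}` on the INTERNAL bonds of `B(y)` (nothing on other bonds), `hRS` for `U`; (M3) the
constants `γ″, κ` are explicit in `d, L, ε, a′`; NOT HERE: the production of the gauges from plaquettes (sequel), `G′`, (3.63)–(3.64), the bond operator
`Δ_a` and its non-local `R` (S-P6′), the tower.
HONEST SCOPE.  [folklore] bookkeeping on the tree's (3.31)–(3.32) and block Poincaré; «NE9 ⇐ the named binders»; NE9 NOT PRINTED ∕ NOT PROVED; NOT summit
progress (cell pub-balaban: spine PROVED 0/9; rung (B)+1 finite T⁴ — NOT infinite volume, NOT mass gap, NOT Clay; HONEST DEPENDENCY: continuum YM on T⁴ ⇐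
BetaPertH ∧ nine spine estimates (0/9 proved); BetaPertH ⇐ (D1) ∧ (D4) ∧ CAP+tail; G-an2-4 gates asym, D1 and NE2/3/4).  Unit `b2b-balaban-t4-ne9-formalise-leaf-03`
(NE9 crux-team leaf prover, gen 63), INTENT I-ne9leaf03-g63-1 part (P1); NEW file; modifies nothing.  Net new unproved facts: 0.
-/

noncomputable section

open scoped BigOperators InnerProductSpace ComplexConjugate

namespace Literature.MathematicalPhysics.QuantumFieldTheory.Balaban1983to89.B9Thm311SitePrimeFormCoerciveBlockGauge

open B4Sect5Torus (TSite)
open B9SectCLatticeCarrier (Bond shift)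
open B9Eq311L2Pairing (WL2)
open B9Eq319QprimeTorus (fineP centre blockCoord mem_blockOf_iff)
open B11Eq103H1Complex (SiteL2K covDerivL2K equiv_covDerivL2K)
open B9Eq310HessianOperator (adTransportW)
open B9Eq326OperatorAssembly (QprimeW)
open B9Eq3119DeltaPiCarrier (laplacePrimeA)
open B9Thm311DeltaPrimeA (re_inner_laplacePrimeA)
open B9Eq328GaugeAction (gaugeU AdW gaugeW equiv_gaugeW covDerivL2K_gaugeU)
open B9Eq333ProjectionCovariance (QprimeW_gaugeU)
open B5Eq172FlatCoercivity (card_blockOf)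
open B9Eq323FlatBlockPoincare (hilbert_blockPoincare sum_internal_le)
open B9Eq319QprimeLipschitz (QprimeW_one_apply sum_blockOf_sum blockMean_norm_sq_le rho_nonneg)
open B9Eq319QprimeBlockLocal (norm_QprimeW_sub_flat_apply_le_local)
open B9Eq33CovDerivVector (covDeriv_apply_dir shiftEquiv)

variable {d : ℕ} (L : ℕ) [NeZero L] (m : Fin d → ℕ)

/-! ## §1 Fibrewise isometry; block Poincaré WITH MEANS on one block -/

section One

variable {𝔸 : Type*} [Ring 𝔸] [Algebra ℂ 𝔸] {W : Type*} [NormedAddCommGroup W] [InnerProductSpace ℂ W] (φ : W ≃ₗ[ℂ] 𝔸)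

omit [NeZero L] in
/-- A fibrewise isometry `R(u)` (print's unitarity of `R(u)` in the norming (18), the displayed `hAd` of `B9Eq328GaugeAction`) preserves norms.
[cite: Balaban1985BackgroundPropagators, (3.30)–(3.31) p.395] -/
theorem norm_AdW_of_inner {u : 𝔸ˣ} (hu : ∀ v v' : W, ⟪AdW φ u v, AdW φ u v'⟫_ℂ = ⟪v, v'⟫_ℂ) (v : W) : ‖AdW φ u v‖ = ‖v‖ := by
  rw [@norm_eq_sqrt_re_inner ℂ, @norm_eq_sqrt_re_inner ℂ, hu]

variable [FiniteDimensional ℂ W]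

/-- **BLOCK POINCARÉ WITH MEANS ON ONE BLOCK**: for every `W`-valued `g` and every block `B(y)`,
`Σ_{x∈B(y)} ‖g x‖² ≤ 2·((L−1)L∕2)·Σ_{b : b₋, b₊ ∈ B(y)} ‖g(b₊) − g(b₋)‖² + 2·L^d·‖L^{−d}Σ_{x∈B(y)} g x‖²` — `g − mean` has vanishing block sum, so
`B9Eq323FlatBlockPoincare.hilbert_blockPoincare` bounds it through the INTERNAL bonds; `‖g x‖² ≤ 2‖(g − mean)x‖² + 2‖mean‖²`, `|B(y)| = L^d` (the parent's
`sum_norm_sq_le_poincare_mean`, one block at a time). [cite: Balaban1983RegularityDecay, (2.27) p.580; Balaban1985Averaging, (2) p.17] -/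
theorem sum_block_norm_sq_le_poincare_mean {n : ℕ} (hn : n + 1 = L) (y : TSite d m) (g : TSite d (fineP L m) → W) :
    ∑ x ∈ B9Eq319QprimeTorus.blockOf L m y, ‖g x‖ ^ 2 ≤
      2 * ((n : ℝ) * (n + 1) / 2) * ∑ b ∈ Finset.univ.filter
          (fun b : Bond d (fineP L m) => blockCoord L m b.1 = y ∧ blockCoord L m (shift b.2 b.1) = y), ‖g (shift b.2 b.1) - g b.1‖ ^ 2 +
        2 * (L : ℝ) ^ d * ‖((L : ℝ) ^ d)⁻¹ • ∑ x ∈ B9Eq319QprimeTorus.blockOf L m y, g x‖ ^ 2 := by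
  classical
  have hL0 : ((L : ℝ)) ^ d ≠ 0 := pow_ne_zero _ (Nat.cast_ne_zero.2 (NeZero.ne L))
  set μ : W := ((L : ℝ) ^ d)⁻¹ • ∑ x ∈ B9Eq319QprimeTorus.blockOf L m y, g x with hμ
  set h : TSite d (fineP L m) → W := fun x => g x - μ with hh
  have hB : Finset.univ.filter (fun x => blockCoord L m x = y) = B9Eq319QprimeTorus.blockOf L m y := rfl
  -- (a) the block sum of `h` over `B(y)` vanishes
  have hsum : ∑ x ∈ Finset.univ.filter (fun x => blockCoord L m x = y), h x = 0 := by
    rw [hB, Finset.sum_sub_distrib, Finset.sum_const, card_blockOf, hμ, ← Nat.cast_smul_eq_nsmul ℝ, smul_smul, Nat.cast_pow,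
      mul_inv_cancel₀ hL0, one_smul, sub_self]
  -- (b) Poincaré for `h` through internal bonds, where `h`'s differences are `g`'s
  have hblock : ∑ x ∈ B9Eq319QprimeTorus.blockOf L m y, ‖h x‖ ^ 2 ≤ (n : ℝ) * (n + 1) / 2 *
      ∑ b ∈ Finset.univ.filter (fun b : Bond d (fineP L m) => blockCoord L m b.1 = y ∧ blockCoord L m (shift b.2 b.1) = y),
        ‖g (shift b.2 b.1) - g b.1‖ ^ 2 := by
    rw [← hB]
    refine (hilbert_blockPoincare L m hn y h hsum).trans (le_of_eq ?_)
    congr 1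
    refine Finset.sum_congr rfl fun b _ => ?_
    rw [hh]
    simp only [sub_sub_sub_cancel_right]
  -- (c) `‖g x‖² ≤ 2‖h x‖² + 2‖μ‖²`
  have hsplit : ∀ x, ‖g x‖ ^ 2 ≤ 2 * ‖h x‖ ^ 2 + 2 * ‖μ‖ ^ 2 := fun x => by
    have e : g x = h x + μ := by rw [hh]; simp
    have h1 : ‖g x‖ ≤ ‖h x‖ + ‖μ‖ := by rw [e]; exact norm_add_le _ _
    nlinarith [norm_nonneg (g x), norm_nonneg (h x), norm_nonneg μ, sq_nonneg (‖h x‖ - ‖μ‖)]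
  have hP : 0 ≤ (n : ℝ) * (n + 1) / 2 := by positivity
  calc ∑ x ∈ B9Eq319QprimeTorus.blockOf L m y, ‖g x‖ ^ 2
      ≤ ∑ x ∈ B9Eq319QprimeTorus.blockOf L m y, (2 * ‖h x‖ ^ 2 + 2 * ‖μ‖ ^ 2) := Finset.sum_le_sum fun x _ => hsplit x
    _ = 2 * ∑ x ∈ B9Eq319QprimeTorus.blockOf L m y, ‖h x‖ ^ 2 + 2 * (L : ℝ) ^ d * ‖μ‖ ^ 2 := by
        rw [Finset.sum_add_distrib, Finset.mul_sum, Finset.sum_const, card_blockOf, nsmul_eq_mul, Nat.cast_pow]; ring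
    _ ≤ _ := by rw [hμ]; linarith [hblock]

end One

/-! ## §2 At `U`, one block, in the block's gauge -/

section Block

variable {𝔸 : Type*} [Ring 𝔸] [Algebra ℂ 𝔸] {W : Type*} [NormedAddCommGroup W] [InnerProductSpace ℂ W] [FiniteDimensional ℂ W]
  (φ : W ≃ₗ[ℂ] 𝔸) {c₀ : ℝ} [Fact (0 < c₀)] {η : ℝ} (hη : η ≠ 0) (U : Bond d (fineP L m) → 𝔸ˣ)
  (g : TSite d m → TSite d (fineP L m) → 𝔸ˣ)
  (hAd : ∀ (y : TSite d m) (x : TSite d (fineP L m)) (v v' : W), ⟪AdW φ (g y x) v, AdW φ (g y x) v'⟫_ℂ = ⟪v, v'⟫_ℂ)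
  {ε : ℝ} (hε : 0 ≤ ε)
  (hR : ∀ (y : TSite d m) (x : TSite d (fineP L m)) (μ : Fin d), blockCoord L m x = y → blockCoord L m (shift μ x) = y →
    ∀ w, ‖adTransportW φ (gaugeU (g y) U) (x, μ) w - w‖ ≤ ε * ‖w‖)

include hη hAd hε hR in
/-- **THE GAUGED BLOCK ESTIMATE**: at block `y`, with `h := R(g y)λ` and `Ũ := U^{g y}` (internal bonds of `B(y)` `ε`-close to the identity in this
gauge): `Σ_{x∈B(y)}‖λ x‖² ≤ (L−1)L·Σ_{b ⊂ B(y)}(2η²‖(D_Uλ)(b)‖² + 2ε²‖λ(b₊)‖²) + 4L^d‖(Q′(U)λ)(y)‖² + 4ρ′(ε)²·Σ_{x∈B(y)}‖λ x‖²` — Poincaré with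
means for `h` (§1); `‖h(b₊) − h(b₋)‖ ≤ |η|‖(D_Ũh)(b)‖ + ε‖h(b₊)‖` and (3.31) `(D_Ũh)(b) = R(g y b₋)(D_Uλ)(b)`; `mean_{B(y)}h = (Q′(1)h)(y)`, (3.32)
`(Q′(Ũ)h)(y) = R(g y (Ly))(Q′(U)λ)(y)` and the local (ρ′) letter `‖(Q′(Ũ)h)(y) − (Q′(1)h)(y)‖ ≤ ρ′·L^{−d}Σ_{B(y)}‖h‖`; `R(g y x)` isometric.
[cite: Balaban1985BackgroundPropagators, (3.31)–(3.32) p.395, (3.35) p.396, Thm 3.11 p.416; Balaban1983RegularityDecay, (2.27) p.580] -/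
theorem sum_block_norm_sq_le_blockGauge {n : ℕ} (hn : n + 1 = L) (lam : SiteL2K ℂ d (fineP L m) c₀ W) (y : TSite d m) :
    ∑ x ∈ B9Eq319QprimeTorus.blockOf L m y, ‖WL2.equiv ℂ (fun _ : TSite d (fineP L m) => c₀) W lam x‖ ^ 2 ≤
      (n : ℝ) * (n + 1) * ∑ b ∈ Finset.univ.filter
          (fun b : Bond d (fineP L m) => blockCoord L m b.1 = y ∧ blockCoord L m (shift b.2 b.1) = y),
          (2 * η ^ 2 * ‖WL2.equiv ℂ (fun _ : Bond d (fineP L m) => c₀) W (covDerivL2K ℂ c₀ ((η : ℂ))⁻¹ (adTransportW φ U) lam) b‖ ^ 2 +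
            2 * ε ^ 2 * ‖WL2.equiv ℂ (fun _ : TSite d (fineP L m) => c₀) W lam (shift b.2 b.1)‖ ^ 2) +
        4 * (L : ℝ) ^ d * ‖QprimeW L m φ U lam y‖ ^ 2 +
        4 * ((1 + ε) ^ (d * (L - 1)) - 1) ^ 2 * ∑ x ∈ B9Eq319QprimeTorus.blockOf L m y, ‖WL2.equiv ℂ (fun _ : TSite d (fineP L m) => c₀) W lam x‖ ^ 2 := by
  classical
  set f := WL2.equiv ℂ (fun _ : TSite d (fineP L m) => c₀) W lam with hfdef
  set h := gaugeW φ (g y) lam with hhdef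
  set hf := WL2.equiv ℂ (fun _ : TSite d (fineP L m) => c₀) W h with hhfdef
  set Ut := gaugeU (g y) U with hUt
  set Df := WL2.equiv ℂ (fun _ : Bond d (fineP L m) => c₀) W (covDerivL2K ℂ c₀ ((η : ℂ))⁻¹ (adTransportW φ U) lam) with hDf
  set ρ := (1 + ε) ^ (d * (L - 1)) - 1 with hρdef
  have hρ0 : 0 ≤ ρ := rho_nonneg L (d := d) hε
  have hLd : (0 : ℝ) < (L : ℝ) ^ d := pow_pos (by exact_mod_cast Nat.pos_of_ne_zero (NeZero.ne L)) _
  -- pointwise readings of the gauged parameter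
  have hhf : ∀ x, hf x = AdW φ (g y x) (f x) := fun x => by rw [hhfdef, hhdef, equiv_gaugeW]
  have hnorm : ∀ x, ‖hf x‖ = ‖f x‖ := fun x => by rw [hhf, norm_AdW_of_inner φ (hAd y x)]
  -- (3.31): the covariant derivative of `h` at `Ũ`, pointwise
  have hD : ∀ (x : TSite d (fineP L m)) (μ : Fin d),
      ((η : ℂ))⁻¹ • (adTransportW φ Ut (x, μ) (hf (shift μ x)) - hf x) = AdW φ (g y x) (Df (x, μ)) := fun x μ => by
    have h1 : WL2.equiv ℂ (fun _ : Bond d (fineP L m) => c₀) W (covDerivL2K ℂ c₀ ((η : ℂ))⁻¹ (adTransportW φ Ut) h) (x, μ) =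
        ((η : ℂ))⁻¹ • (adTransportW φ Ut (x, μ) (hf (shift μ x)) - hf x) := by
      rw [equiv_covDerivL2K, covDeriv_apply_dir]
    rw [← h1, hhdef, hUt, covDerivL2K_gaugeU, equiv_gaugeW]
  -- (2b) the internal bond differences of `h`
  have hbond : ∀ (x : TSite d (fineP L m)) (μ : Fin d), blockCoord L m x = y → blockCoord L m (shift μ x) = y →
      ‖hf (shift μ x) - hf x‖ ^ 2 ≤ 2 * η ^ 2 * ‖Df (x, μ)‖ ^ 2 + 2 * ε ^ 2 * ‖f (shift μ x)‖ ^ 2 := by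
    intro x μ hx hxμ
    have hηC : ((η : ℂ)) ≠ 0 := by exact_mod_cast hη
    have e : hf (shift μ x) - hf x = (hf (shift μ x) - adTransportW φ Ut (x, μ) (hf (shift μ x))) +
        ((η : ℂ)) • (((η : ℂ))⁻¹ • (adTransportW φ Ut (x, μ) (hf (shift μ x)) - hf x)) := by
      rw [smul_smul, mul_inv_cancel₀ hηC, one_smul]; abel
    have h2 : ‖((η : ℂ)) • (((η : ℂ))⁻¹ • (adTransportW φ Ut (x, μ) (hf (shift μ x)) - hf x))‖ = |η| * ‖Df (x, μ)‖ := by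
      rw [hD, norm_smul, Complex.norm_real, Real.norm_eq_abs, norm_AdW_of_inner φ (hAd y x)]
    have h3 : ‖hf (shift μ x) - adTransportW φ Ut (x, μ) (hf (shift μ x))‖ ≤ ε * ‖f (shift μ x)‖ := by
      rw [← norm_neg, neg_sub, ← hnorm (shift μ x)]; exact hR y x μ hx hxμ _
    have h1 : ‖hf (shift μ x) - hf x‖ ≤ |η| * ‖Df (x, μ)‖ + ε * ‖f (shift μ x)‖ := by
      rw [e]; exact (norm_add_le _ _).trans (by rw [h2]; linarith [h3])
    have hp : 0 ≤ |η| * ‖Df (x, μ)‖ := by positivity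
    have hq : 0 ≤ ε * ‖f (shift μ x)‖ := by positivity
    have hsq : ‖hf (shift μ x) - hf x‖ * ‖hf (shift μ x) - hf x‖ ≤
        (|η| * ‖Df (x, μ)‖ + ε * ‖f (shift μ x)‖) * (|η| * ‖Df (x, μ)‖ + ε * ‖f (shift μ x)‖) :=
      mul_le_mul h1 h1 (norm_nonneg _) (by positivity)
    nlinarith [hsq, sq_nonneg (|η| * ‖Df (x, μ)‖ - ε * ‖f (shift μ x)‖), sq_abs η]
  -- (2c) the block mean of `h` against `(Q′(U)λ)(y)`
  have hmean_eq : ((L : ℝ) ^ d)⁻¹ • ∑ x ∈ B9Eq319QprimeTorus.blockOf L m y, hf x =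
      QprimeW L m φ (fun _ : Bond d (fineP L m) => (1 : 𝔸ˣ)) (c₀ := c₀) h y := by
    rw [QprimeW_one_apply, Finset.smul_sum]; rfl
  have hQcov : ‖QprimeW L m φ Ut (c₀ := c₀) h y‖ = ‖QprimeW L m φ U lam y‖ := by
    rw [hhdef, hUt, QprimeW_gaugeU]; exact norm_AdW_of_inner φ (hAd y _) _
  have hsumf : ∑ x ∈ B9Eq319QprimeTorus.blockOf L m y, ‖(WL2.linearEquiv ℂ ℂ (fun _ : TSite d (fineP L m) => c₀) h) x‖ =
      ∑ x ∈ B9Eq319QprimeTorus.blockOf L m y, ‖f x‖ := Finset.sum_congr rfl fun x _ => hnorm x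
  have hmean : ‖((L : ℝ) ^ d)⁻¹ • ∑ x ∈ B9Eq319QprimeTorus.blockOf L m y, hf x‖ ≤
      ‖QprimeW L m φ U lam y‖ + ρ * (((L : ℝ) ^ d)⁻¹ * ∑ x ∈ B9Eq319QprimeTorus.blockOf L m y, ‖f x‖) := by
    have hloc := norm_QprimeW_sub_flat_apply_le_local L m φ Ut (c₀ := c₀) hε y (hR y) h
    rw [hsumf, ← hρdef] at hloc
    rw [hmean_eq, ← hQcov]
    exact (norm_le_insert (QprimeW L m φ Ut (c₀ := c₀) h y) _).trans (by linarith [hloc])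
  have hmean_sq : ‖((L : ℝ) ^ d)⁻¹ • ∑ x ∈ B9Eq319QprimeTorus.blockOf L m y, hf x‖ ^ 2 ≤
      2 * ‖QprimeW L m φ U lam y‖ ^ 2 + 2 * ρ ^ 2 * (((L : ℝ) ^ d)⁻¹ * ∑ x ∈ B9Eq319QprimeTorus.blockOf L m y, ‖f x‖ ^ 2) := by
    have hJ := blockMean_norm_sq_le L m f y
    have hA : 0 ≤ ‖QprimeW L m φ U lam y‖ := norm_nonneg _
    have hBm : 0 ≤ ((L : ℝ) ^ d)⁻¹ * ∑ x ∈ B9Eq319QprimeTorus.blockOf L m y, ‖f x‖ :=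
      mul_nonneg (by positivity) (Finset.sum_nonneg fun _ _ => norm_nonneg _)
    have hsq : ‖((L : ℝ) ^ d)⁻¹ • ∑ x ∈ B9Eq319QprimeTorus.blockOf L m y, hf x‖ *
        ‖((L : ℝ) ^ d)⁻¹ • ∑ x ∈ B9Eq319QprimeTorus.blockOf L m y, hf x‖ ≤
        (‖QprimeW L m φ U lam y‖ + ρ * (((L : ℝ) ^ d)⁻¹ * ∑ x ∈ B9Eq319QprimeTorus.blockOf L m y, ‖f x‖)) *
          (‖QprimeW L m φ U lam y‖ + ρ * (((L : ℝ) ^ d)⁻¹ * ∑ x ∈ B9Eq319QprimeTorus.blockOf L m y, ‖f x‖)) :=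
      mul_le_mul hmean hmean (norm_nonneg _) (by positivity)
    have hρJ : ρ ^ 2 * (((L : ℝ) ^ d)⁻¹ * ∑ x ∈ B9Eq319QprimeTorus.blockOf L m y, ‖f x‖) ^ 2 ≤
        ρ ^ 2 * (((L : ℝ) ^ d)⁻¹ * ∑ x ∈ B9Eq319QprimeTorus.blockOf L m y, ‖f x‖ ^ 2) := mul_le_mul_of_nonneg_left hJ (sq_nonneg _)
    nlinarith [hsq, hρJ, sq_nonneg (‖QprimeW L m φ U lam y‖ - ρ * (((L : ℝ) ^ d)⁻¹ * ∑ x ∈ B9Eq319QprimeTorus.blockOf L m y, ‖f x‖))]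
  -- (2a) Poincaré with means for `h` on `B(y)` and the bond differences
  have hPoinc := sum_block_norm_sq_le_poincare_mean L m hn y hf
  have hdiff : ∑ b ∈ Finset.univ.filter (fun b : Bond d (fineP L m) => blockCoord L m b.1 = y ∧ blockCoord L m (shift b.2 b.1) = y),
      ‖hf (shift b.2 b.1) - hf b.1‖ ^ 2 ≤
      ∑ b ∈ Finset.univ.filter (fun b : Bond d (fineP L m) => blockCoord L m b.1 = y ∧ blockCoord L m (shift b.2 b.1) = y),
        (2 * η ^ 2 * ‖Df b‖ ^ 2 + 2 * ε ^ 2 * ‖f (shift b.2 b.1)‖ ^ 2) :=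
    Finset.sum_le_sum fun b hb => by
      simp only [Finset.mem_filter, Finset.mem_univ, true_and] at hb
      exact hbond b.1 b.2 hb.1 hb.2
  have hlhs : ∑ x ∈ B9Eq319QprimeTorus.blockOf L m y, ‖f x‖ ^ 2 = ∑ x ∈ B9Eq319QprimeTorus.blockOf L m y, ‖hf x‖ ^ 2 :=
    Finset.sum_congr rfl fun x _ => by rw [hnorm]
  have hP : 0 ≤ (n : ℝ) * (n + 1) / 2 := by positivity
  have hmid : 2 * (L : ℝ) ^ d * (2 * ρ ^ 2 * (((L : ℝ) ^ d)⁻¹ * ∑ x ∈ B9Eq319QprimeTorus.blockOf L m y, ‖f x‖ ^ 2)) =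
      4 * ρ ^ 2 * ∑ x ∈ B9Eq319QprimeTorus.blockOf L m y, ‖f x‖ ^ 2 := by
    field_simp
    ring
  calc ∑ x ∈ B9Eq319QprimeTorus.blockOf L m y, ‖f x‖ ^ 2 = ∑ x ∈ B9Eq319QprimeTorus.blockOf L m y, ‖hf x‖ ^ 2 := hlhs
    _ ≤ 2 * ((n : ℝ) * (n + 1) / 2) * ∑ b ∈ Finset.univ.filter
            (fun b : Bond d (fineP L m) => blockCoord L m b.1 = y ∧ blockCoord L m (shift b.2 b.1) = y), ‖hf (shift b.2 b.1) - hf b.1‖ ^ 2 +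
          2 * (L : ℝ) ^ d * ‖((L : ℝ) ^ d)⁻¹ • ∑ x ∈ B9Eq319QprimeTorus.blockOf L m y, hf x‖ ^ 2 := hPoinc
    _ ≤ 2 * ((n : ℝ) * (n + 1) / 2) * ∑ b ∈ Finset.univ.filter
            (fun b : Bond d (fineP L m) => blockCoord L m b.1 = y ∧ blockCoord L m (shift b.2 b.1) = y),
            (2 * η ^ 2 * ‖Df b‖ ^ 2 + 2 * ε ^ 2 * ‖f (shift b.2 b.1)‖ ^ 2) +
          2 * (L : ℝ) ^ d * (2 * ‖QprimeW L m φ U lam y‖ ^ 2 +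
            2 * ρ ^ 2 * (((L : ℝ) ^ d)⁻¹ * ∑ x ∈ B9Eq319QprimeTorus.blockOf L m y, ‖f x‖ ^ 2)) := by
        gcongr
    _ = _ := by rw [mul_add (2 * (L : ℝ) ^ d), hmid]; ring

end Block

/-! ## §3 Summed over the blocks, in the chain's weighted currency -/

section Global

variable {𝔸 : Type*} [Ring 𝔸] [Algebra ℂ 𝔸] {W : Type*} [NormedAddCommGroup W] [InnerProductSpace ℂ W] [FiniteDimensional ℂ W]
  (φ : W ≃ₗ[ℂ] 𝔸) {c₀ c₁ : ℝ} [Fact (0 < c₀)] [Fact (0 < c₁)] {η : ℝ} (hη : η ≠ 0) (U : Bond d (fineP L m) → 𝔸ˣ)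
  (g : TSite d m → TSite d (fineP L m) → 𝔸ˣ)
  (hAd : ∀ (y : TSite d m) (x : TSite d (fineP L m)) (v v' : W), ⟪AdW φ (g y x) v, AdW φ (g y x) v'⟫_ℂ = ⟪v, v'⟫_ℂ)
  {ε : ℝ} (hε : 0 ≤ ε)
  (hR : ∀ (y : TSite d m) (x : TSite d (fineP L m)) (μ : Fin d), blockCoord L m x = y → blockCoord L m (shift μ x) = y →
    ∀ w, ‖adTransportW φ (gaugeU (g y) U) (x, μ) w - w‖ ≤ ε * ‖w‖)

omit [FiniteDimensional ℂ W] [Fact (0 < c₀)] in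
/-- The `c₁`-weighted reading `Q̃′(U)λ` has squared norm `c₁·Σ_y ‖(Q′(U)λ)(y)‖²`. [cite: Balaban1985BackgroundPropagators, (3.19) p.393, (3.24) p.394] -/
theorem norm_sq_Qtilde (lam : SiteL2K ℂ d (fineP L m) c₀ W) :
    ‖((WL2.linearEquiv ℂ ℂ (fun _ : TSite d m => c₁)).symm.toLinearMap ∘ₗ QprimeW L m φ U) lam‖ ^ 2 = c₁ * ∑ y : TSite d m, ‖QprimeW L m φ U lam y‖ ^ 2 := by
  rw [WL2.norm_sq (𝕜 := ℂ) (w := fun _ : TSite d m => c₁) (V := W), Finset.mul_sum]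
  refine Finset.sum_congr rfl fun y _ => ?_
  rw [LinearMap.comp_apply]
  simp only [LinearEquiv.coe_coe, WL2.linearEquiv_symm_apply, Equiv.apply_symm_apply]

omit [NeZero L] in
/-- Each site is the endpoint `b₊` of exactly `d` bonds: `Σ_b F(b₊) = d·Σ_x F(x)`. [cite: Balaban1985BackgroundPropagators, (3.3) p.390] -/
theorem sum_bond_tgt_eq (F : TSite d (fineP L m) → ℝ) : ∑ b : Bond d (fineP L m), F (shift b.2 b.1) = d * ∑ x, F x := by
  rw [Fintype.sum_prod_type, Finset.sum_comm]
  have h : ∀ μ : Fin d, ∑ x : TSite d (fineP L m), F (shift μ x) = ∑ x, F x := fun μ =>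
    Equiv.sum_comp (shiftEquiv (Pd := fineP L m) μ) F
  simp only [h, Finset.sum_const, Finset.card_univ, Fintype.card_fin, nsmul_eq_mul]

include hη hAd hε hR in
/-- **POINCARÉ WITH MEANS AT `U`, IN THE CHAIN's LETTERS**: for EVERY gauge parameter `λ`,
`(1 − κ)·‖λ‖² ≤ 2(L−1)Lη²·‖D_Uλ‖² + 4(c₀L^d∕c₁)·‖Q̃′(U)λ‖²`, `κ = 2d(L−1)L·ε² + 4ρ′(ε)²`, `ρ′(ε) = (1 + ε)^{d(L−1)} − 1` — §2 summed over the
blocks (`sum_blockOf_sum`), internal bonds ≤ all bonds (`sum_internal_le`), each site is `b₊` of `d` bonds, `‖λ‖² = c₀Σ_x‖λ x‖²`, `‖D_Uλ‖² = c₀Σ_b‖…‖²`,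
`‖Q̃′λ‖² = c₁Σ_y‖…‖²`. [cite: Balaban1985BackgroundPropagators, (3.24) p.394, (3.31)–(3.32) p.395, Thm 3.11 p.416; Balaban1983RegularityDecay, (2.27) p.580] -/
theorem norm_sq_le_site_squares_blockGauge (lam : SiteL2K ℂ d (fineP L m) c₀ W) :
    (1 - (2 * d * (((L : ℝ) - 1) * L) * ε ^ 2 + 4 * ((1 + ε) ^ (d * (L - 1)) - 1) ^ 2)) * ‖lam‖ ^ 2 ≤
      2 * (((L : ℝ) - 1) * L) * η ^ 2 * ‖covDerivL2K ℂ c₀ ((η : ℂ))⁻¹ (adTransportW φ U) lam‖ ^ 2 +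
        4 * (c₀ * (L : ℝ) ^ d / c₁) * ‖((WL2.linearEquiv ℂ ℂ (fun _ : TSite d m => c₁)).symm.toLinearMap ∘ₗ QprimeW L m φ U) lam‖ ^ 2 := by
  classical
  have hc₀ : 0 < c₀ := Fact.out
  have hc₁ : 0 < c₁ := Fact.out
  obtain ⟨n, hn⟩ : ∃ n, n + 1 = L := ⟨L - 1, Nat.sub_add_cancel (Nat.one_le_iff_ne_zero.2 (NeZero.ne L))⟩
  have hnL : ((L : ℝ) - 1) * L = (n : ℝ) * (n + 1) := by rw [← hn]; push_cast; ring
  set f := WL2.equiv ℂ (fun _ : TSite d (fineP L m) => c₀) W lam with hfdef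
  set Df := WL2.equiv ℂ (fun _ : Bond d (fineP L m) => c₀) W (covDerivL2K ℂ c₀ ((η : ℂ))⁻¹ (adTransportW φ U) lam) with hDf
  set ρ := (1 + ε) ^ (d * (L - 1)) - 1 with hρdef
  set G : Bond d (fineP L m) → ℝ := fun b => 2 * η ^ 2 * ‖Df b‖ ^ 2 + 2 * ε ^ 2 * ‖f (shift b.2 b.1)‖ ^ 2 with hG
  have hG0 : ∀ b, 0 ≤ G b := fun b => by rw [hG]; positivity
  -- the three weighted norms
  have hlam : ‖lam‖ ^ 2 = c₀ * ∑ x, ‖f x‖ ^ 2 := by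
    rw [WL2.norm_sq (𝕜 := ℂ) (w := fun _ : TSite d (fineP L m) => c₀) (V := W), Finset.mul_sum]
  have hD : ‖covDerivL2K ℂ c₀ ((η : ℂ))⁻¹ (adTransportW φ U) lam‖ ^ 2 = c₀ * ∑ b, ‖Df b‖ ^ 2 := by
    rw [WL2.norm_sq (𝕜 := ℂ) (w := fun _ : Bond d (fineP L m) => c₀) (V := W), Finset.mul_sum]
  have hQ := norm_sq_Qtilde L m φ (c₁ := c₁) U lam
  -- §2 summed over the blocks
  have hblocks : ∑ x, ‖f x‖ ^ 2 ≤ (n : ℝ) * (n + 1) * ∑ b, G b + 4 * (L : ℝ) ^ d * ∑ y, ‖QprimeW L m φ U lam y‖ ^ 2 + 4 * ρ ^ 2 * ∑ x, ‖f x‖ ^ 2 := by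
    rw [← sum_blockOf_sum L m (fun x => ‖f x‖ ^ 2)]
    have h1 := fun y => sum_block_norm_sq_le_blockGauge L m φ hη U g hAd hε hR hn lam y
    refine (Finset.sum_le_sum fun y _ => h1 y).trans ?_
    rw [Finset.sum_add_distrib, Finset.sum_add_distrib, ← Finset.mul_sum, ← Finset.mul_sum, ← Finset.mul_sum]
    have hint := sum_internal_le (blockCoord L m) (fun b : Bond d (fineP L m) => b.1) (fun b : Bond d (fineP L m) => shift b.2 b.1) G hG0
    have hnn : 0 ≤ (n : ℝ) * (n + 1) := by positivity
    nlinarith [mul_le_mul_of_nonneg_left hint hnn]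
  -- the bond sums
  have hGsum : ∑ b, G b = 2 * η ^ 2 * ∑ b, ‖Df b‖ ^ 2 + 2 * ε ^ 2 * (d * ∑ x, ‖f x‖ ^ 2) := by
    rw [hG]
    simp only
    rw [Finset.sum_add_distrib, ← Finset.mul_sum, ← Finset.mul_sum, sum_bond_tgt_eq L m (fun x => ‖f x‖ ^ 2)]
  rw [hGsum] at hblocks
  -- assemble in the weighted currency
  have hS0 : 0 ≤ ∑ x, ‖f x‖ ^ 2 := Finset.sum_nonneg fun _ _ => sq_nonneg _
  have key : c₀ * ∑ x, ‖f x‖ ^ 2 ≤ (n : ℝ) * (n + 1) * (2 * η ^ 2 * (c₀ * ∑ b, ‖Df b‖ ^ 2)) +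
      2 * d * ((n : ℝ) * (n + 1)) * ε ^ 2 * (c₀ * ∑ x, ‖f x‖ ^ 2) +
      4 * (c₀ * (L : ℝ) ^ d / c₁) * (c₁ * ∑ y, ‖QprimeW L m φ U lam y‖ ^ 2) + 4 * ρ ^ 2 * (c₀ * ∑ x, ‖f x‖ ^ 2) := by
    have h := mul_le_mul_of_nonneg_left hblocks hc₀.le
    have e : 4 * (c₀ * (L : ℝ) ^ d / c₁) * (c₁ * ∑ y, ‖QprimeW L m φ U lam y‖ ^ 2) =
        c₀ * (4 * (L : ℝ) ^ d * ∑ y, ‖QprimeW L m φ U lam y‖ ^ 2) := by field_simp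
    rw [e]; nlinarith [h]
  rw [hlam, hD, hQ, hnL]
  nlinarith [key]

end Global

/-! ## §4 The strong form of `Δ′_{a′}(U)` along Bałaban's normalisation -/

section Strong

variable {𝔸 : Type*} [Ring 𝔸] [Algebra ℂ 𝔸] {W : Type*} [NormedAddCommGroup W] [InnerProductSpace ℂ W] [FiniteDimensional ℂ W]
  (φ : W ≃ₗ[ℂ] 𝔸) {c₀ c₁ : ℝ} [Fact (0 < c₀)] [Fact (0 < c₁)] {η : ℝ} (hη : η ≠ 0) (U : Bond d (fineP L m) → 𝔸ˣ)
  (hRS : ∀ (b : Bond d (fineP L m)) (v u : W), ⟪adTransportW φ U b v, u⟫_ℂ = ⟪v, adTransportW φ (fun b => (U b)⁻¹) b u⟫_ℂ)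
  (g : TSite d m → TSite d (fineP L m) → 𝔸ˣ)
  (hAd : ∀ (y : TSite d m) (x : TSite d (fineP L m)) (v v' : W), ⟪AdW φ (g y x) v, AdW φ (g y x) v'⟫_ℂ = ⟪v, v'⟫_ℂ)
  {ε : ℝ} (hε : 0 ≤ ε)
  (hR : ∀ (y : TSite d m) (x : TSite d (fineP L m)) (μ : Fin d), blockCoord L m x = y → blockCoord L m (shift μ x) = y →
    ∀ w, ‖adTransportW φ (gaugeU (g y) U) (x, μ) w - w‖ ≤ ε * ‖w‖)

include hη hRS hAd hε hR in
/-- **THE STRONG FORM OF `Δ′_{a′}(U)` AT A BACKGROUND WITH SMALL-BOND BLOCK GAUGES, ALONG BAŁABAN's NORMALISATION**: with `c₁(ηL)² = c₀L^d`, `0 < ηL`,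
`a′ > 0`: `(1∕(3 + 4∕a′))·(‖D_Uλ‖² + (1 − κ)·(ηL)⁻²‖λ‖²) ≤ re⟨λ, Δ′_{a′}(U)λ⟩ = ‖D_Uλ‖² + a′‖Q̃′(U)λ‖²` (`B9Thm311DeltaPrimeA.re_inner_laplacePrimeA`),
`κ = 2d(L−1)L·ε² + 4((1 + ε)^{d(L−1)} − 1)²` — §3 with `(L−1)Lη² ≤ (ηL)²`, `c₀L^d∕c₁ = (ηL)²`.  Print's p. 395 «Δ′_a is positive» ∕ Thm 3.11 for the site
operator at every background admitting such gauges — every flat sector of the torus, no closed line; constants free of `m, η, c₀, c₁`.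
[cite: Balaban1985BackgroundPropagators, (3.24) p.394, p.395, (3.35) p.396, Thm 3.11 p.416; Balaban1983RegularityDecay, (2.27) p.580] -/
theorem site_strong_coercive_blockGauge {a' : ℝ} (ha' : 0 < a') (hηL0 : 0 < η * L) (hs : c₁ * (η * L) ^ 2 = c₀ * (L : ℝ) ^ d)
    (lam : SiteL2K ℂ d (fineP L m) c₀ W) :
    (1 / (3 + 4 / a')) * (‖covDerivL2K ℂ c₀ ((η : ℂ))⁻¹ (adTransportW φ U) lam‖ ^ 2 +
        (1 - (2 * d * (((L : ℝ) - 1) * L) * ε ^ 2 + 4 * ((1 + ε) ^ (d * (L - 1)) - 1) ^ 2)) * (((η * L)⁻¹) ^ 2 * ‖lam‖ ^ 2)) ≤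
      RCLike.re ⟪lam, laplacePrimeA L m φ η U a' (c₁ := c₁) lam⟫_ℂ := by
  have hc₀ : 0 < c₀ := Fact.out
  have hc₁ : 0 < c₁ := Fact.out
  have hLr : (0 : ℝ) < L := by exact_mod_cast Nat.pos_of_ne_zero (NeZero.ne L)
  rw [re_inner_laplacePrimeA L m φ η U a' hRS]
  set D := ‖covDerivL2K ℂ c₀ ((η : ℂ))⁻¹ (adTransportW φ U) lam‖ ^ 2 with hDdef
  set Q := ‖((WL2.linearEquiv ℂ ℂ (fun _ : TSite d m => c₁)).symm.toLinearMap ∘ₗ QprimeW L m φ U) lam‖ ^ 2 with hQdef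
  set κ := 2 * d * (((L : ℝ) - 1) * L) * ε ^ 2 + 4 * ((1 + ε) ^ (d * (L - 1)) - 1) ^ 2 with hκ
  have hP := norm_sq_le_site_squares_blockGauge L m φ (c₁ := c₁) hη U g hAd hε hR lam
  rw [← hDdef, ← hQdef, ← hκ] at hP
  have hratio : c₀ * (L : ℝ) ^ d / c₁ = (η * L) ^ 2 := by rw [← hs]; field_simp
  rw [hratio] at hP
  have hD0 : 0 ≤ D := by rw [hDdef]; positivity
  have hQ0 : 0 ≤ Q := by rw [hQdef]; positivity
  have hηL2 : 0 < (η * L) ^ 2 := by positivity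
  -- `(1 − κ)(ηL)⁻²‖λ‖² ≤ 2D + 4Q`
  have hmass : (1 - κ) * (((η * L)⁻¹) ^ 2 * ‖lam‖ ^ 2) ≤ 2 * D + 4 * Q := by
    have h1 : 2 * (((L : ℝ) - 1) * L) * η ^ 2 * D ≤ 2 * (η * L) ^ 2 * D := by
      have : ((L : ℝ) - 1) * L * η ^ 2 ≤ (η * L) ^ 2 := by nlinarith [sq_nonneg η, hLr]
      nlinarith
    have h2 : (1 - κ) * ‖lam‖ ^ 2 ≤ (η * L) ^ 2 * (2 * D + 4 * Q) := by nlinarith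
    have h3 : (1 - κ) * (((η * L)⁻¹) ^ 2 * ‖lam‖ ^ 2) = ((η * L) ^ 2)⁻¹ * ((1 - κ) * ‖lam‖ ^ 2) := by rw [inv_pow]; ring
    rw [h3, inv_mul_le_iff₀ hηL2]
    exact h2
  have ha3 : 0 < 3 + 4 / a' := by positivity
  rw [one_div, inv_mul_le_iff₀ ha3]
  have hexp : (3 + 4 / a') * (D + a' * Q) = 3 * D + 4 * Q + (4 / a') * D + 3 * (a' * Q) := by
    field_simp
    ring
  rw [hexp]
  have h4 : 0 ≤ (4 / a') * D := by positivity
  have h5 : 0 ≤ a' * Q := by positivity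
  linarith [hmass]

end Strong

end Literature.MathematicalPhysics.QuantumFieldTheory.Balaban1983to89.B9Thm311SitePrimeFormCoerciveBlockGauge

end
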